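import Summits.QuantumAdvantage.QuantumAdvantage.Theorems.CubicForrelationNearExactIsExactKtGapAll

/-!
# Crux `CubicForrelation.NearExactIsExact` (stmt-QuantumAdvantage-14043) — the Kasami–Tokura gap `(1.5d, 1.75d)` for EVERY order, III: the
  Diophantine system has no solution (uniform in the number of bits AND in the order)

Certificate seat `b2b-cforr-cert` (gen 45).  HONEST FRAMING: elementary ARITHMETIC (standard axioms).  The system produced by the inductive
step `kto_step` (…KtGapOrderStep) — `w = 6L + t`, `0 < t < L = 2^k`, `2L ∣ w²`, `A + B + 1 = n₁ + n₂ + 1 = N = 2^{k+r+3}`,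
Parseval `A t² + B (2L+t)² + w² = N w`, `n₁ (2L+t) + n₂ t + w = w²`, fourth moment `w⁴ + A t⁴ + B (2L+t)⁴ = N (w² + n₁ (2L+t)² + n₂ t²)` —
has NO solution in naturals, for every `k` and every `r ≥ 1`.  The order-3 closing of the tree (`ktg_no_solution_all`, gen 16/19) used
`N = 32 L`; here `N = 2^{r+2}·2L` is a free power of two, and the argument is new and shorter:
* `2L ∣ t²` (from `2L ∣ w²`) and `t² < 8L` (Parseval: `(N − 1) t² ≤ N w − w²`), so `t² ∈ {2L, 4L, 6L}`; `6L` is not a square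
  (`ktg_sq_ne_three_mul_two_pow`), and `t < L` forces `t ≥ 4` resp. `t ≥ 8` in the two remaining cases (`ktg_sq_eq_two_pow`);
* ELIMINATION: the combination `e₅ − t⁴ e₁ − (s² + t²)(e₂ − t² e₁) + N t² e₃ + N (s + t)(e₄ − t e₃)` of the five equations (`s = 2L + t`)
  is free of `A, B, n₁, n₂`; with `N = c t²` it reads `t⁶·g(c,t) = 0`, where
  `g = c²(t+1) − c(7t²+19t+12) + 72t²+84t+24` (`t² = 2L`, `c = 2^{r+2}`) resp. `g = 2c²(t+2) − c(4t²+21t+20) + 18t²+42t+24`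
  (`t² = 4L`, `c = 2^{r+1}`) (`kto_elim_one`, `kto_elim_two`, checked by `linear_combination`);
* 2-ADIC VALUATION: with `8 ∣ c, 4 ∣ t` resp. `4 ∣ c, 8 ∣ t` one has `g ≡ 8 (mod 16)`, so `g ≠ 0` (`kto_val_one`, `kto_val_two`).
NOT summit progress.

References: T. Kasami, N. Tokura, IEEE Trans. IT 16 (1970) 752–759 (the theorem being re-proved); the argument is this work's.  Axioms: standard.
-/

set_option linter.dupNamespace false -- D-0017: single-problem summit ⇒ `QuantumAdvantage.QuantumAdvantage` by design

noncomputable section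

namespace Summit.QuantumAdvantage.QuantumAdvantage.Theorems.CubicForrelation.NearExactIsExact

/-! ### Elimination identities (pure algebra) -/

/-- **Elimination, case `t² = 2L`** (so `2L + t = t² + t`, `w = 6L + t = 3t² + t`, `N = c t²`): the five equations force
`t⁶ · (c²(t+1) − c(7t²+19t+12) + 72t²+84t+24) = 0`. [this work] -/
theorem kto_elim_one (t c A B n₁ n₂ : ℝ) (e1 : A + B + 1 = c * t ^ 2)
    (e2 : A * t ^ 2 + B * (t ^ 2 + t) ^ 2 + (3 * t ^ 2 + t) ^ 2 = c * t ^ 2 * (3 * t ^ 2 + t))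
    (e3 : n₁ + n₂ + 1 = c * t ^ 2) (e4 : n₁ * (t ^ 2 + t) + n₂ * t + (3 * t ^ 2 + t) = (3 * t ^ 2 + t) ^ 2)
    (e5 : (3 * t ^ 2 + t) ^ 4 + A * t ^ 4 + B * (t ^ 2 + t) ^ 4 =
      c * t ^ 2 * ((3 * t ^ 2 + t) ^ 2 + n₁ * (t ^ 2 + t) ^ 2 + n₂ * t ^ 2)) :
    t ^ 6 * (c ^ 2 * (t + 1) - c * (7 * t ^ 2 + 19 * t + 12) + (72 * t ^ 2 + 84 * t + 24)) = 0 := by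
  linear_combination e5 - t ^ 4 * e1 - ((t ^ 2 + t) ^ 2 + t ^ 2) * (e2 - t ^ 2 * e1) + c * t ^ 2 * t ^ 2 * e3 +
    c * t ^ 2 * ((t ^ 2 + t) + t) * (e4 - t * e3)

/-- **Elimination, case `t² = 4L`** (so `2L + t = t²/2 + t`, `w = 3t²/2 + t`, `N = c t²`): the five equations force
`t⁶ · (2c²(t+2) − c(4t²+21t+20) + 18t²+42t+24) = 0`. [this work] -/
theorem kto_elim_two (t c A B n₁ n₂ : ℝ) (e1 : A + B + 1 = c * t ^ 2)
    (e2 : A * t ^ 2 + B * (t ^ 2 / 2 + t) ^ 2 + (3 * t ^ 2 / 2 + t) ^ 2 = c * t ^ 2 * (3 * t ^ 2 / 2 + t))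
    (e3 : n₁ + n₂ + 1 = c * t ^ 2) (e4 : n₁ * (t ^ 2 / 2 + t) + n₂ * t + (3 * t ^ 2 / 2 + t) = (3 * t ^ 2 / 2 + t) ^ 2)
    (e5 : (3 * t ^ 2 / 2 + t) ^ 4 + A * t ^ 4 + B * (t ^ 2 / 2 + t) ^ 4 =
      c * t ^ 2 * ((3 * t ^ 2 / 2 + t) ^ 2 + n₁ * (t ^ 2 / 2 + t) ^ 2 + n₂ * t ^ 2)) :
    t ^ 6 * (2 * c ^ 2 * (t + 2) - c * (4 * t ^ 2 + 21 * t + 20) + (18 * t ^ 2 + 42 * t + 24)) = 0 := by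
  linear_combination (4 : ℝ) * (e5 - t ^ 4 * e1 - ((t ^ 2 / 2 + t) ^ 2 + t ^ 2) * (e2 - t ^ 2 * e1) + c * t ^ 2 * t ^ 2 * e3 +
    c * t ^ 2 * ((t ^ 2 / 2 + t) + t) * (e4 - t * e3))

/-! ### The 2-adic kills -/

/-- **Case `t² = 2L` dies 2-adically**: for integers `c = 8v`, `t = 4u`, `c²(t+1) − c(7t²+19t+12) + 72t²+84t+24 ≡ 8 (mod 16)`, so it is
not `0`. [this work] -/
theorem kto_val_one (u v : ℤ) :
    (8 * v) ^ 2 * (4 * u + 1) - 8 * v * (7 * (4 * u) ^ 2 + 19 * (4 * u) + 12) + (72 * (4 * u) ^ 2 + 84 * (4 * u) + 24) ≠ 0 := by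
  intro h
  have e : (8 * v) ^ 2 * (4 * u + 1) - 8 * v * (7 * (4 * u) ^ 2 + 19 * (4 * u) + 12) + (72 * (4 * u) ^ 2 + 84 * (4 * u) + 24) =
      16 * (4 * v ^ 2 * (4 * u + 1) - v * (56 * u ^ 2 + 38 * u + 6) + 72 * u ^ 2 + 21 * u + 1) + 8 := by ring
  rw [e] at h
  omega

/-- **Case `t² = 4L` dies 2-adically**: for integers `c = 4v`, `t = 8u`, `2c²(t+2) − c(4t²+21t+20) + 18t²+42t+24 ≡ 8 (mod 16)`, so it is
not `0`. [this work] -/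
theorem kto_val_two (u v : ℤ) :
    2 * (4 * v) ^ 2 * (8 * u + 2) - 4 * v * (4 * (8 * u) ^ 2 + 21 * (8 * u) + 20) + (18 * (8 * u) ^ 2 + 42 * (8 * u) + 24) ≠ 0 := by
  intro h
  have e : 2 * (4 * v) ^ 2 * (8 * u + 2) - 4 * v * (4 * (8 * u) ^ 2 + 21 * (8 * u) + 20) + (18 * (8 * u) ^ 2 + 42 * (8 * u) + 24) =
      16 * (2 * v ^ 2 * (8 * u + 2) - v * (64 * u ^ 2 + 42 * u + 5) + 72 * u ^ 2 + 21 * u + 1) + 8 := by ring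
  rw [e] at h
  omega

/-! ### The system has no solution -/

/-- **Parseval kills `t² ≥ 8·2^k`** (every `N ≥ 8`): with `A + B + 1 = N`, `A t² + B (2·2^k + t)² + w² = N·w` and `w < 7·2^k`,
the lower bound `(A + B) t² ≤ N·w − w²` forces `t² < 8·2^k`. [this work] -/
theorem kto_t_sq_lt (k N w t A B : ℕ) (hN : 8 ≤ N) (h2 : w < 7 * 2 ^ k) (hAB : A + B + 1 = N)
    (hP : A * t ^ 2 + B * (2 * 2 ^ k + t) ^ 2 + w ^ 2 = N * w) : t * t < 8 * 2 ^ k := by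
  by_contra hge
  push Not at hge
  have hP' : (A + B) * (t * t) + w * w ≤ N * w := by
    have h1 : B * (t * t) ≤ B * ((2 * 2 ^ k + t) * (2 * 2 ^ k + t)) :=
      Nat.mul_le_mul_left _ (Nat.mul_le_mul (by omega) (by omega))
    nlinarith [hP]
  have hAB' : A + B = N - 1 := by omega
  rw [hAB'] at hP'
  have h3 : (N - 1) * (8 * 2 ^ k) ≤ (N - 1) * (t * t) := Nat.mul_le_mul_left _ hge
  have h4 : N * w < N * (7 * 2 ^ k) := Nat.mul_lt_mul_of_pos_left h2 (by omega)
  have hN1 : 1 ≤ N := by omega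
  zify [hN1] at *
  nlinarith [h3, h4, hP', Nat.two_pow_pos k]

/-- **No solution, every `k` and every `r ≥ 1`.**  The system of `kto_step` (with `N = 2^{k+r+3}`) has no solution in naturals.
See the module docstring. [this work] -/
theorem kto_no_solution (k r w t A B n₁ n₂ : ℕ) (hr : 1 ≤ r) (hw : w = 6 * 2 ^ k + t) (ht : 0 < t) (h2 : w < 7 * 2 ^ k)
    (hdvd : 2 * 2 ^ k ∣ w * w) (hAB : A + B + 1 = 2 ^ (k + r + 2 + 1))
    (hP : A * t ^ 2 + B * (2 * 2 ^ k + t) ^ 2 + w ^ 2 = 2 ^ (k + r + 2 + 1) * w)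
    (hn : n₁ + n₂ + 1 = 2 ^ (k + r + 2 + 1)) (hI : n₁ * (2 * 2 ^ k + t) + n₂ * t + w = w ^ 2)
    (h4 : w ^ 4 + A * t ^ 4 + B * (2 * 2 ^ k + t) ^ 4 = 2 ^ (k + r + 2 + 1) * (w ^ 2 + n₁ * (2 * 2 ^ k + t) ^ 2 + n₂ * t ^ 2)) :
    False := by
  -- `2·2^k ∣ t²`
  have hdvd_t : 2 * 2 ^ k ∣ t * t := by
    have e : w * w = t * t + 2 * 2 ^ k * (18 * 2 ^ k + 6 * t) := by rw [hw]; ring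
    rw [e] at hdvd
    exact (Nat.dvd_add_left (dvd_mul_right _ _)).1 hdvd
  -- `t² < 8·2^k`
  have hN8 : 8 ≤ 2 ^ (k + r + 2 + 1) := by
    calc (8 : ℕ) = 2 ^ 3 := by norm_num
      _ ≤ 2 ^ (k + r + 2 + 1) := Nat.pow_le_pow_right (by norm_num) (by omega)
  have htlt : t * t < 8 * 2 ^ k := kto_t_sq_lt k _ w t A B hN8 h2 hAB hP
  have htL : t < 2 ^ k := by omega
  -- `t² = q · 2^{k+1}` with `q ∈ {1, 2, 3}`
  obtain ⟨q, hq⟩ := hdvd_t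
  have hq4 : q < 4 := by
    by_contra hq4; push Not at hq4
    have : 2 * 2 ^ k * 4 ≤ 2 * 2 ^ k * q := Nat.mul_le_mul_left _ hq4
    omega
  have hq1 : 1 ≤ q := by
    rcases Nat.eq_zero_or_pos q with h0 | h0
    · rw [h0, mul_zero, mul_self_eq_zero] at hq
      omega
    · exact h0
  -- real forms of the five equations
  obtain ⟨r', rfl⟩ : ∃ r', r = r' + 1 := ⟨r - 1, by omega⟩
  have eR1 : (A : ℝ) + B + 1 = (2 : ℝ) ^ (k + (r' + 1) + 2 + 1) := by exact_mod_cast hAB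
  have eR2 : (A : ℝ) * (t : ℝ) ^ 2 + B * (2 * 2 ^ k + t) ^ 2 + (w : ℝ) ^ 2 = (2 : ℝ) ^ (k + (r' + 1) + 2 + 1) * w := by
    exact_mod_cast hP
  have eR3 : (n₁ : ℝ) + n₂ + 1 = (2 : ℝ) ^ (k + (r' + 1) + 2 + 1) := by exact_mod_cast hn
  have eR4 : (n₁ : ℝ) * (2 * 2 ^ k + t) + n₂ * t + w = (w : ℝ) ^ 2 := by exact_mod_cast hI
  have eR5 : (w : ℝ) ^ 4 + A * (t : ℝ) ^ 4 + B * (2 * 2 ^ k + t) ^ 4 =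
      (2 : ℝ) ^ (k + (r' + 1) + 2 + 1) * ((w : ℝ) ^ 2 + n₁ * (2 * 2 ^ k + t) ^ 2 + n₂ * (t : ℝ) ^ 2) := by exact_mod_cast h4
  have hwR : (w : ℝ) = 6 * 2 ^ k + t := by rw [hw]; push_cast; ring
  have ht0 : (t : ℝ) ≠ 0 := by exact_mod_cast ht.ne'
  interval_cases q
  · -- `t² = 2^{k+1}`: `k + 1 = 2j`, `t = 2^j`, `j ≥ 2`
    obtain ⟨j, hkj, htj⟩ := ktg_sq_eq_two_pow (k + 1) t (by rw [hq]; ring)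
    have hj2 : 2 ≤ j := by
      by_contra hj
      push Not at hj
      interval_cases j
      · omega
      · have hk : k = 1 := by omega
        subst hk; rw [htj] at htL; norm_num at htL
    obtain ⟨i, rfl⟩ : ∃ i, j = i + 2 := ⟨j - 2, by omega⟩
    -- real substitution: `2^k = t²/2`, `N = 2^{r'+3}·t²`
    have hL : (2 : ℝ) ^ k = (t : ℝ) ^ 2 / 2 := by
      have e : ((t * t : ℕ) : ℝ) = ((2 * 2 ^ k * 1 : ℕ) : ℝ) := by rw [hq]
      push_cast at e
      linarith
    have hNc : (2 : ℝ) ^ (k + (r' + 1) + 2 + 1) = 2 ^ (r' + 3) * (t : ℝ) ^ 2 := by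
      rw [show (2 : ℝ) ^ (k + (r' + 1) + 2 + 1) = 2 ^ (r' + 3) * (2 * 2 ^ k) by ring, hL]; ring
    set c : ℝ := (2 : ℝ) ^ (r' + 3) with hc
    rw [hNc] at eR1 eR2 eR3 eR5
    rw [hwR, hL] at eR2 eR4 eR5
    have key := kto_elim_one (t : ℝ) c A B n₁ n₂ eR1 (by linear_combination eR2) eR3 (by linear_combination eR4)
      (by linear_combination eR5)
    have hg : c ^ 2 * ((t : ℝ) + 1) - c * (7 * (t : ℝ) ^ 2 + 19 * t + 12) + (72 * (t : ℝ) ^ 2 + 84 * t + 24) = 0 := by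
      have ht6 : (t : ℝ) ^ 6 ≠ 0 := pow_ne_zero _ ht0
      exact (mul_eq_zero.1 key).resolve_left ht6
    -- integer form with `c = 8·2^{r'}`, `t = 4·2^i`
    have hcZ : c = ((8 * 2 ^ r' : ℤ) : ℝ) := by rw [hc]; push_cast; ring
    have htZ : (t : ℝ) = ((4 * 2 ^ i : ℤ) : ℝ) := by rw [htj]; push_cast; ring
    rw [hcZ, htZ] at hg
    have hgZ : ((8 * 2 ^ r' : ℤ)) ^ 2 * (4 * 2 ^ i + 1) - (8 * 2 ^ r') * (7 * (4 * 2 ^ i) ^ 2 + 19 * (4 * 2 ^ i) + 12) +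
        (72 * (4 * 2 ^ i) ^ 2 + 84 * (4 * 2 ^ i) + 24) = 0 := by exact_mod_cast hg
    exact kto_val_one (2 ^ i) (2 ^ r') hgZ
  · -- `t² = 2^{k+2}`: `k + 2 = 2j`, `t = 2^j`, `j ≥ 3`
    obtain ⟨j, hkj, htj⟩ := ktg_sq_eq_two_pow (k + 2) t (by rw [hq]; ring)
    have hj3 : 3 ≤ j := by
      by_contra hj
      push Not at hj
      interval_cases j
      · omega
      · have hk : k = 0 := by omega
        subst hk; rw [htj] at htL; norm_num at htL
      · have hk : k = 2 := by omega
        subst hk; rw [htj] at htL; norm_num at htL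
    obtain ⟨i, rfl⟩ : ∃ i, j = i + 3 := ⟨j - 3, by omega⟩
    have hL : (2 : ℝ) ^ k = (t : ℝ) ^ 2 / 4 := by
      have e : ((t * t : ℕ) : ℝ) = ((2 * 2 ^ k * 2 : ℕ) : ℝ) := by rw [hq]
      push_cast at e
      linarith
    have hNc : (2 : ℝ) ^ (k + (r' + 1) + 2 + 1) = 2 ^ (r' + 2) * (t : ℝ) ^ 2 := by
      rw [show (2 : ℝ) ^ (k + (r' + 1) + 2 + 1) = 2 ^ (r' + 2) * (4 * 2 ^ k) by ring, hL]; ring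
    set c : ℝ := (2 : ℝ) ^ (r' + 2) with hc
    rw [hNc] at eR1 eR2 eR3 eR5
    rw [hwR, hL] at eR2 eR4 eR5
    have key := kto_elim_two (t : ℝ) c A B n₁ n₂ eR1 (by linear_combination eR2) eR3 (by linear_combination eR4)
      (by linear_combination eR5)
    have hg : 2 * c ^ 2 * ((t : ℝ) + 2) - c * (4 * (t : ℝ) ^ 2 + 21 * t + 20) + (18 * (t : ℝ) ^ 2 + 42 * t + 24) = 0 := by
      have ht6 : (t : ℝ) ^ 6 ≠ 0 := pow_ne_zero _ ht0
      exact (mul_eq_zero.1 key).resolve_left ht6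
    have hcZ : c = ((4 * 2 ^ r' : ℤ) : ℝ) := by rw [hc]; push_cast; ring
    have htZ : (t : ℝ) = ((8 * 2 ^ i : ℤ) : ℝ) := by rw [htj]; push_cast; ring
    rw [hcZ, htZ] at hg
    have hgZ : 2 * ((4 * 2 ^ r' : ℤ)) ^ 2 * (8 * 2 ^ i + 2) - (4 * 2 ^ r') * (4 * (8 * 2 ^ i) ^ 2 + 21 * (8 * 2 ^ i) + 20) +
        (18 * (8 * 2 ^ i) ^ 2 + 42 * (8 * 2 ^ i) + 24) = 0 := by exact_mod_cast hg
    exact kto_val_two (2 ^ i) (2 ^ r') hgZ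
  · -- `t² = 3 · 2^{k+1}`: not a square
    exact ktg_sq_ne_three_mul_two_pow (k + 1) t (by rw [hq]; ring)

end Summit.QuantumAdvantage.QuantumAdvantage.Theorems.CubicForrelation.NearExactIsExact

end
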